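import Mathlib
import HarnessLib
import Literature.Probability.Percolation.CornerPercolation
import Literature.Probability.Percolation.ProdBernoulliRusso
import Literature.Probability.Percolation.HalfPlaneUCatch
import Literature.Probability.LatticeModels.DomainDiscretisation
import Literature.Barriers.CriticalPhenomena.EmbeddingModulusUniqueness

/-!
# Crux `SegmentOpen` (stmt-CriticalPhenomena-5471), line `Sketch`:
# stub `stub_crossingProbPolynomial`

Worker file. The theorem name, namespace, `open` lines and the statement text are EXACTLY those
registered by the lead's skeleton (`work/SegmentOpen.lean`, `Cruxes/SegmentOpen/Lines/Sketch.lean`);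
do not change them. Helper lemmas: `private`, above the theorem, each with a docstring.

S1 of the line: for a conformal rectangle `R` and a mesh `δ > 0`, the crude crossing probability
`t ↦ P_t(R, δ) = cornerCrossingProb t R δ` of the corner model `M_t` is (the restriction to
`[0, 1]` of) a real polynomial. Proof: only the finitely many vertices `y` of `ℤ²` with
`δ √2 (y₀ + i y₁) ∈ R.carrier` are looked at (`meshVertices_finite`, the carrier is bounded), the
crude crossing event depends only on the edges joining two of them
(`HalfPlaneArm.determinedBy_openCrossing_of_finite`), and the state of the edge `{v, v + e_j}`
reads the coin and the splitting bit of `v` only (`mem_cornerConfig_iff`); so the coin-space event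
is a cylinder event over a finite set `K` of coordinates, and
`RussoPath.prodBernoulli_real_eq_sum_powerset` writes its probability as
`Σ_{T ⊆ K, T ∈ event} ∏_{i ∈ K} (p_i if i ∈ T else 1 - p_i)` with `p_{(v,0)} = 1/2`,
`p_{(v,1)} = t/2`, i.e. `p_i = (1/2) t^{j}` for `i = (v, j)`: a polynomial in `t`.
-/

noncomputable section

namespace Summit.CriticalPhenomena.CardyFormulaZ2.Theorems

open Literature.Probability Literature.Barriers.CriticalPhenomena
open Literature.Probability.RandomPlanarGeometry (ConformalRectangle ConformalEquiv MarkedDomain)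
open Filter Set Topology

open Literature.Probability.LatticeModels Literature.Probability.Percolation in
/-- For `δ > 0` only finitely many vertices of `ℤ²` are drawn (on `√2 ℤ²`, at mesh `δ`) inside
the bounded carrier of `R`: they are the mesh vertices of the carrier at mesh `δ √2`
(`meshVertices_finite`). -/
private theorem finite_verts (R : ConformalRectangle) {δ : ℝ} (hδ : 0 < δ) :
    {y : Site 2 | (δ : ℂ) * squareLatticeEmbedding.z y ∈ R.carrier}.Finite := by
  -- adapted from `verts_finite` (Theorems/CardySelfDualSegmentUniformMarginalityDefs.lean)
  have h : {y : Site 2 | (δ : ℂ) * squareLatticeEmbedding.z y ∈ R.carrier} =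
      meshVertices R.carrier (δ * Real.sqrt 2) := by
    ext y
    simp only [Set.mem_setOf_eq, mem_meshVertices_iff, meshPoint]
    rw [show squareLatticeEmbedding.z y = (Real.sqrt 2 : ℂ) * Site.toComplex y from rfl,
      ← mul_assoc, Complex.ofReal_mul]
  rw [h]
  exact meshVertices_finite R.isBounded (mul_pos hδ (Real.sqrt_pos.2 two_pos))

open Literature.Probability.LatticeModels Literature.Probability.Percolation in
/-- For `δ > 0` the coin-space form `{S | cornerConfig S ∈ E}` of the crude crossing event `E` is
a cylinder event over the coins and splitting bits of the finitely many vertices drawn in the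
carrier: `E` depends only on the edges with both endpoints drawn in the carrier
(`HalfPlaneArm.determinedBy_openCrossing_of_finite`), and the state of such an edge
`{v, v + e_j}` reads the two bits at `v` only (`mem_cornerConfig_iff`). -/
private theorem determinedBy_coinEvent (R : ConformalRectangle) {δ : ℝ} (hδ : 0 < δ) :
    DeterminedBy
      {S : Set (Site 2 × Fin 2) | cornerConfig S ∈
        embDomainCrossing squareLatticeEmbedding.z R.carrier δ (R.arc 0) (R.arc 2)}
      ↑((finite_verts R hδ).toFinset ×ˢ (Finset.univ : Finset (Fin 2))) := by
  -- adapted from `determinedBy_coinEvent`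
  -- (Theorems/CardySelfDualSegmentUniformMarginalityDefs.lean)
  have hE := HalfPlaneArm.determinedBy_openCrossing_of_finite (finite_verts R hδ)
    {u | Metric.infDist ((δ : ℂ) * squareLatticeEmbedding.z u) (R.arc 0) ≤ 2 * δ}
    {v | Metric.infDist ((δ : ℂ) * squareLatticeEmbedding.z v) (R.arc 2) ≤ 2 * δ}
  rw [determinedBy_iff] at hE ⊢
  intro S S' hSS'
  -- the two coin sets agree on the bits of the drawn vertices
  have hcoin : ∀ v : Site 2, (δ : ℂ) * squareLatticeEmbedding.z v ∈ R.carrier →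
      ∀ j : Fin 2, ((v, j) ∈ S ↔ (v, j) ∈ S') := by
    intro v hv j
    have hmem : (v, j) ∈ (↑((finite_verts R hδ).toFinset ×ˢ (Finset.univ : Finset (Fin 2))) :
        Set (Site 2 × Fin 2)) := by
      rw [Finset.coe_product, Finset.coe_univ, Set.Finite.coe_toFinset]
      exact ⟨hv, Set.mem_univ _⟩
    exact ⟨fun h => ((Set.ext_iff.1 hSS' (v, j)).1 ⟨h, hmem⟩).1,
      fun h => ((Set.ext_iff.1 hSS' (v, j)).2 ⟨h, hmem⟩).1⟩
  -- hence the two corner configurations agree on the edges joining two drawn vertices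
  refine hE (cornerConfig S) (cornerConfig S') ?_
  ext e
  refine and_congr_left fun he => ?_
  rw [mem_cornerConfig_iff, mem_cornerConfig_iff]
  refine exists_congr fun v => or_congr (and_congr_right fun hev => ?_)
    (and_congr_right fun hev => ?_)
  · exact hcoin v (he v (hev ▸ Sym2.mem_mk_left _ _)) 0
  · have hv : (δ : ℂ) * squareLatticeEmbedding.z v ∈ R.carrier :=
      he v (hev ▸ Sym2.mem_mk_left _ _)
    exact iff_congr (hcoin v hv 0) (not_congr (hcoin v hv 1))

open Literature.Probability.Percolation in
/-- The parameters of the corner model as monomials in `t`: `p_{(v, j)} = (1/2) t^j`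
(`1/2` on coins, `t/2` on splitting bits). -/
private theorem coe_cornerParam_eq (t : unitInterval) (i : LatticeModels.Site 2 × Fin 2) :
    ((cornerParam t i : unitInterval) : ℝ) = 1 / 2 * (t : ℝ) ^ (i.2 : ℕ) := by
  obtain ⟨v, j⟩ := i
  fin_cases j <;> simp

/-- S1 (M). For fixed `R, δ > 0` the crude crossing probability is a polynomial in `t`: the event is
a cylinder event on the finitely many vertices drawn in the bounded carrier
(`determinedBy_openCrossing_of_finite`-type locality pulled back along `cornerConfig`), and
`RussoPath.prodBernoulli_real_eq_sum_powerset` writes its probability as a finite sum of products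
of the weights `1/2, 1/2, t/2, 1 - t/2`. -/
theorem stub_crossingProbPolynomial :
    ∀ (R : ConformalRectangle) (δ : ℝ), 0 < δ →
      ∃ p : Polynomial ℝ, ∀ t : unitInterval,
        Percolation.cornerCrossingProb t R δ = p.eval (t : ℝ) := by
  intro R δ hδ
  classical
  set K : Finset (LatticeModels.Site 2 × Fin 2) :=
    (finite_verts R hδ).toFinset ×ˢ (Finset.univ : Finset (Fin 2))
  set B : Set (Set (LatticeModels.Site 2 × Fin 2)) :=
    {S | Percolation.cornerConfig S ∈ Percolation.embDomainCrossing
      LatticeModels.squareLatticeEmbedding.z R.carrier δ (R.arc 0) (R.arc 2)}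
  have hB : Percolation.DeterminedBy B ↑K := determinedBy_coinEvent R hδ
  -- the cylinder polynomial: weights `(1/2) X^j` in place of the parameters `p_{(v, j)}`
  refine ⟨∑ T ∈ K.powerset, if (↑T : Set (LatticeModels.Site 2 × Fin 2)) ∈ B then
      ∏ i ∈ K, (if i ∈ T then Polynomial.C (1 / 2 : ℝ) * Polynomial.X ^ (i.2 : ℕ)
        else 1 - Polynomial.C (1 / 2 : ℝ) * Polynomial.X ^ (i.2 : ℕ)) else 0, fun t => ?_⟩
  have h :=
    Percolation.RussoPath.prodBernoulli_real_eq_sum_powerset hB (Percolation.cornerParam t)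
  change (LatticeModels.prodBernoulli (Percolation.cornerParam t)).real B = _
  rw [h, Polynomial.eval_finsetSum]
  refine Finset.sum_congr rfl fun T _ => ?_
  by_cases hT : (↑T : Set (LatticeModels.Site 2 × Fin 2)) ∈ B
  · simp only [if_pos hT, Polynomial.eval_prod]
    refine Finset.prod_congr rfl fun i _ => ?_
    by_cases hi : i ∈ T
    · simp only [if_pos hi, Polynomial.eval_mul, Polynomial.eval_C, Polynomial.eval_pow,
        Polynomial.eval_X, coe_cornerParam_eq]
    · simp only [if_neg hi, Polynomial.eval_sub, Polynomial.eval_one, Polynomial.eval_mul,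
        Polynomial.eval_C, Polynomial.eval_pow, Polynomial.eval_X, coe_cornerParam_eq]
  · simp only [if_neg hT, Polynomial.eval_zero]

end Summit.CriticalPhenomena.CardyFormulaZ2.Theorems
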